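import Summits.CriticalPhenomena.PercolationContinuityZ3.Theorems.PercNearOneGluingNoHeavyLowerTailForestRayleighTwoSumSameSide
import Summits.CriticalPhenomena.PercolationContinuityZ3.Theorems.PercNearOneGluingNoHeavyLowerTailForestRayleighTwoSumSplitSide
import Summits.CriticalPhenomena.PercolationContinuityZ3.Theorems.PercNearOneGluingNoHeavyLowerTailForestRayleighDispatch
import HarnessLib

/-!
# Weighted forest negative correlation — 2-sums IV: assembling the cases (splitting `D, K` along the sides)

**Theorem (`forestsW_rayleigh_twoSum`).** Let `E₁, E₂ ⊆ Sym2 V` be loop-free edge systems whose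
edges live on vertex sets `S₁`, `S₂` with `S₁ ∩ S₂ ⊆ {s,t}`, `s ≠ t`, and let the marker
`m = st` lie in neither. If the weighted forest Rayleigh inequality

  `(R)(D;K;e,f) : Z(D;K∪{e,f})·Z(D;K) ≤ Z(D;K∪{e})·Z(D;K∪{f})`,
  `Z(D;K) = Σ_{G ⊆ D, ⟨G ∪ K⟩ acyclic} ∏_{g∈G} w g`,

holds for every instance inside `E₁ ∪ {m}` and every instance inside `E₂ ∪ {m}` (all
activities `w ≥ 0`, all disjoint free/pinned sets `D, K`, all `e ≠ f` outside `D ∪ K`), then it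
holds for every instance inside `E₁ ∪ E₂ ∪ {m}` — the 2-sum of the two systems along `m`, marker
kept (deleting or contracting it are the instances with `m` absent or pinned). In matroid language:
the class of *independence-correlated* (`I`-Rayleigh) graphic matroids is closed under 2-sums
[Semple–Welsh, *Negative correlation in graphs and matroids*, CPC 17 (2008), §5 Question 2;
proved for all matroids by Cocks and by Wagner, *Negatively correlated random variables and Mason's
conjecture*, Ann. Comb. 12 (2008); here an elementary kernel proof for graphs via the two-state
decomposition of `…TwoSeparationSums`]. Degenerate separations (`|S₁ ∩ S₂| ≤ 1`) are included.

Proof: split `D, K` along the sides (`split_sides`) and dispatch on the positions of `e`, `f` and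
the marker to `lsm_sep_same(_free/_pin)`, `lsm_sep_split(_free/_pin)`, `lsm_sep_marker`, whose
inputs are instances of `(R)` inside `Eᵢ ∪ {m}`. Theorems only; no definitions, no `sorry`.
-/

open Finset SimpleGraph
open scoped Classical

namespace Summit.CriticalPhenomena.PercolationContinuityZ3.Theorems.ForestRayleigh

variable {V : Type*} [Fintype V] [DecidableEq V]

omit [Fintype V] in
/-- Splitting a marker-free edge set of the 2-sum along the two sides. [elementary] -/
theorem split_sides {E₁ E₂ X : Finset (Sym2 V)} {m : Sym2 V} (hX : X ⊆ insert m (E₁ ∪ E₂))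
    (hmX : m ∉ X) :
    ∃ X₁ X₂ : Finset (Sym2 V), X₁ ⊆ E₁ ∧ X₂ ⊆ E₂ ∧ Disjoint X₁ X₂ ∧ X = X₁ ∪ X₂ := by
  refine ⟨X.filter (fun z => z ∈ E₁), X.filter (fun z => z ∉ E₁), ?_, ?_, ?_, ?_⟩
  · intro z hz
    exact (Finset.mem_filter.1 hz).2
  · intro z hz
    obtain ⟨hzX, hz₁⟩ := Finset.mem_filter.1 hz
    rcases Finset.mem_insert.1 (hX hzX) with rfl | h
    · exact absurd hzX hmX
    · rcases Finset.mem_union.1 h with h | h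
      · exact absurd h hz₁
      · exact h
  · exact Finset.disjoint_filter_filter_not X X _
  · exact (Finset.filter_union_filter_not_eq _ X).symm

/-! ### §1 The three asymmetric cases -/

/-- **Case `e = m`, `f` on side 2.** [S–W 2008 §5 Q.2, graphic case] -/
theorem twoSum_case_marker
    {E₁ E₂ : Finset (Sym2 V)} {S₁ S₂ : Set V} {s t : V}
    (hE₁ : ∀ z ∈ E₁, ∀ x ∈ z, x ∈ S₁) (hE₂ : ∀ z ∈ E₂, ∀ x ∈ z, x ∈ S₂)
    (hS : ∀ x, x ∈ S₁ → x ∈ S₂ → x = s ∨ x = t) (hst : s ≠ t)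
    (hL₁ : ∀ z ∈ E₁, ¬z.IsDiag) (hL₂ : ∀ z ∈ E₂, ¬z.IsDiag)
    (hm₁ : s(s, t) ∉ E₁) (hm₂ : s(s, t) ∉ E₂)
    (hR₂ : ∀ (w : Sym2 V → ℝ), (∀ x, 0 ≤ w x) → ∀ (D K : Finset (Sym2 V)) (e f : Sym2 V),
      D ∪ insert e (insert f K) ⊆ insert s(s, t) E₂ → Disjoint D K → e ∉ D → e ∉ K → f ∉ D →
      f ∉ K → e ≠ f →
      (∑ G ∈ D.powerset.filter (fun G =>
        (fromEdgeSet ((G ∪ (insert e (insert f K)) : Finset (Sym2 V)) : Set (Sym2 V))).IsAcyclic), ∏ x ∈ G, w x) *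
        (∑ G ∈ D.powerset.filter (fun G =>
        (fromEdgeSet ((G ∪ (K) : Finset (Sym2 V)) : Set (Sym2 V))).IsAcyclic), ∏ x ∈ G, w x) ≤
      (∑ G ∈ D.powerset.filter (fun G =>
        (fromEdgeSet ((G ∪ (insert e K) : Finset (Sym2 V)) : Set (Sym2 V))).IsAcyclic), ∏ x ∈ G, w x) *
        (∑ G ∈ D.powerset.filter (fun G =>
        (fromEdgeSet ((G ∪ (insert f K) : Finset (Sym2 V)) : Set (Sym2 V))).IsAcyclic), ∏ x ∈ G, w x))
    (w : Sym2 V → ℝ) (hw : ∀ x, 0 ≤ w x) (D K : Finset (Sym2 V)) (e f : Sym2 V)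
    (hsub : D ∪ insert e (insert f K) ⊆ insert s(s, t) (E₁ ∪ E₂)) (hDK : Disjoint D K)
    (heD : e ∉ D) (heK : e ∉ K) (hfD : f ∉ D) (hfK : f ∉ K) (hef : e ≠ f)
    (he : e = s(s, t)) (hf : f ∈ E₂) :
    (∑ G ∈ D.powerset.filter (fun G =>
        (fromEdgeSet ((G ∪ (insert e (insert f K)) : Finset (Sym2 V)) : Set (Sym2 V))).IsAcyclic), ∏ x ∈ G, w x) *
      (∑ G ∈ D.powerset.filter (fun G =>
        (fromEdgeSet ((G ∪ (K) : Finset (Sym2 V)) : Set (Sym2 V))).IsAcyclic), ∏ x ∈ G, w x) ≤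
    (∑ G ∈ D.powerset.filter (fun G =>
        (fromEdgeSet ((G ∪ (insert e K) : Finset (Sym2 V)) : Set (Sym2 V))).IsAcyclic), ∏ x ∈ G, w x) *
      (∑ G ∈ D.powerset.filter (fun G =>
        (fromEdgeSet ((G ∪ (insert f K) : Finset (Sym2 V)) : Set (Sym2 V))).IsAcyclic), ∏ x ∈ G, w x) := by
  subst he
  have hmK : s(s, t) ∉ K := heK
  have hDsub : D ⊆ insert s(s, t) (E₁ ∪ E₂) := fun z hz => hsub (Finset.mem_union_left _ hz)
  have hKsub : K ⊆ insert s(s, t) (E₁ ∪ E₂) := fun z hz =>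
    hsub (Finset.mem_union_right _ (Finset.mem_insert_of_mem (Finset.mem_insert_of_mem hz)))
  obtain ⟨D₁, D₂, hD₁, hD₂, hD₁₂, rfl⟩ := split_sides hDsub heD
  obtain ⟨K₁, K₂, hK₁, hK₂, -, rfl⟩ := split_sides hKsub hmK
  have hfm : f ≠ s(s, t) := fun h => hm₂ (h ▸ hf)
  have hA₁ : D₁ ∪ K₁ ⊆ E₁ := Finset.union_subset hD₁ hK₁
  have hA₂ : D₂ ∪ insert f K₂ ⊆ E₂ := Finset.union_subset hD₂ (Finset.insert_subset hf hK₂)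
  have hfD₂ : f ∉ D₂ := fun h => hfD (Finset.mem_union_right _ h)
  have hfK₂ : f ∉ K₂ := fun h => hfK (Finset.mem_union_right _ h)
  have hmD₂ : s(s, t) ∉ D₂ := fun h => hm₂ (hD₂ h)
  have hmK₂ : s(s, t) ∉ K₂ := fun h => hm₂ (hK₂ h)
  have hDK₂ : Disjoint D₂ K₂ := by
    refine Finset.disjoint_left.2 fun z hz hz' => ?_
    exact Finset.disjoint_left.1 hDK (Finset.mem_union_right _ hz) (Finset.mem_union_right _ hz')
  refine lsm_sep_marker w f (fun z hz => hE₁ z (hA₁ hz)) (fun z hz => hE₂ z (hA₂ hz)) hS hst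
    (fun z hz => hL₁ z (hA₁ hz)) (fun z hz => hL₂ z (hA₂ hz)) (fun h => hm₁ (hA₁ h))
    (fun h => hm₂ (hA₂ h)) hD₁₂ ?_
  refine hR₂ w hw D₂ K₂ f s(s, t) ?_ hDK₂ hfD₂ hfK₂ hmD₂ hmK₂ hfm
  exact Finset.union_subset (hD₂.trans (Finset.subset_insert _ _))
    (Finset.insert_subset (Finset.mem_insert_of_mem hf)
      (Finset.insert_subset (Finset.mem_insert_self _ _) (hK₂.trans (Finset.subset_insert _ _))))

/-- **Case `e, f` on side 1** (marker absent, free or pinned). [S–W 2008 §5 Q.2, graphic case] -/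
theorem twoSum_case_same
    {E₁ E₂ : Finset (Sym2 V)} {S₁ S₂ : Set V} {s t : V}
    (hE₁ : ∀ z ∈ E₁, ∀ x ∈ z, x ∈ S₁) (hE₂ : ∀ z ∈ E₂, ∀ x ∈ z, x ∈ S₂)
    (hS : ∀ x, x ∈ S₁ → x ∈ S₂ → x = s ∨ x = t) (hst : s ≠ t)
    (hL₁ : ∀ z ∈ E₁, ¬z.IsDiag) (hL₂ : ∀ z ∈ E₂, ¬z.IsDiag)
    (hm₁ : s(s, t) ∉ E₁) (hm₂ : s(s, t) ∉ E₂)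
    (hR₁ : ∀ (w : Sym2 V → ℝ), (∀ x, 0 ≤ w x) → ∀ (D K : Finset (Sym2 V)) (e f : Sym2 V),
      D ∪ insert e (insert f K) ⊆ insert s(s, t) E₁ → Disjoint D K → e ∉ D → e ∉ K → f ∉ D →
      f ∉ K → e ≠ f →
      (∑ G ∈ D.powerset.filter (fun G =>
        (fromEdgeSet ((G ∪ (insert e (insert f K)) : Finset (Sym2 V)) : Set (Sym2 V))).IsAcyclic), ∏ x ∈ G, w x) *
        (∑ G ∈ D.powerset.filter (fun G =>
        (fromEdgeSet ((G ∪ (K) : Finset (Sym2 V)) : Set (Sym2 V))).IsAcyclic), ∏ x ∈ G, w x) ≤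
      (∑ G ∈ D.powerset.filter (fun G =>
        (fromEdgeSet ((G ∪ (insert e K) : Finset (Sym2 V)) : Set (Sym2 V))).IsAcyclic), ∏ x ∈ G, w x) *
        (∑ G ∈ D.powerset.filter (fun G =>
        (fromEdgeSet ((G ∪ (insert f K) : Finset (Sym2 V)) : Set (Sym2 V))).IsAcyclic), ∏ x ∈ G, w x))
    (w : Sym2 V → ℝ) (hw : ∀ x, 0 ≤ w x) (D K : Finset (Sym2 V)) (e f : Sym2 V)
    (hsub : D ∪ insert e (insert f K) ⊆ insert s(s, t) (E₁ ∪ E₂)) (hDK : Disjoint D K)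
    (heD : e ∉ D) (heK : e ∉ K) (hfD : f ∉ D) (hfK : f ∉ K) (hef : e ≠ f)
    (he : e ∈ E₁) (hf : f ∈ E₁) :
    (∑ G ∈ D.powerset.filter (fun G =>
        (fromEdgeSet ((G ∪ (insert e (insert f K)) : Finset (Sym2 V)) : Set (Sym2 V))).IsAcyclic), ∏ x ∈ G, w x) *
      (∑ G ∈ D.powerset.filter (fun G =>
        (fromEdgeSet ((G ∪ (K) : Finset (Sym2 V)) : Set (Sym2 V))).IsAcyclic), ∏ x ∈ G, w x) ≤
    (∑ G ∈ D.powerset.filter (fun G =>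
        (fromEdgeSet ((G ∪ (insert e K) : Finset (Sym2 V)) : Set (Sym2 V))).IsAcyclic), ∏ x ∈ G, w x) *
      (∑ G ∈ D.powerset.filter (fun G =>
        (fromEdgeSet ((G ∪ (insert f K) : Finset (Sym2 V)) : Set (Sym2 V))).IsAcyclic), ∏ x ∈ G, w x) := by
  have hem : e ≠ s(s, t) := fun h => hm₁ (h ▸ he)
  have hfm : f ≠ s(s, t) := fun h => hm₁ (h ▸ hf)
  have hDsub : D ⊆ insert s(s, t) (E₁ ∪ E₂) := fun z hz => hsub (Finset.mem_union_left _ hz)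
  have hKsub : K ⊆ insert s(s, t) (E₁ ∪ E₂) := fun z hz =>
    hsub (Finset.mem_union_right _ (Finset.mem_insert_of_mem (Finset.mem_insert_of_mem hz)))
  -- the side-1 inputs, for given side-1 parts `D₁ ⊆ D`, `K₁ ⊆ K`
  have inputs : ∀ D₁ K₁ : Finset (Sym2 V), D₁ ⊆ E₁ → K₁ ⊆ E₁ → D₁ ⊆ D → K₁ ⊆ K →
      (∀ lam : ℝ, 0 ≤ lam →
        (∑ G ∈ (insert s(s, t) D₁).powerset.filter (fun G =>
        (fromEdgeSet ((G ∪ (insert e (insert f K₁)) : Finset (Sym2 V)) : Set (Sym2 V))).IsAcyclic), ∏ x ∈ G, Function.update w s(s, t) lam x) *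
          (∑ G ∈ (insert s(s, t) D₁).powerset.filter (fun G =>
        (fromEdgeSet ((G ∪ (K₁) : Finset (Sym2 V)) : Set (Sym2 V))).IsAcyclic), ∏ x ∈ G, Function.update w s(s, t) lam x) ≤
        (∑ G ∈ (insert s(s, t) D₁).powerset.filter (fun G =>
        (fromEdgeSet ((G ∪ (insert e K₁) : Finset (Sym2 V)) : Set (Sym2 V))).IsAcyclic), ∏ x ∈ G, Function.update w s(s, t) lam x) *
          (∑ G ∈ (insert s(s, t) D₁).powerset.filter (fun G =>
        (fromEdgeSet ((G ∪ (insert f K₁) : Finset (Sym2 V)) : Set (Sym2 V))).IsAcyclic), ∏ x ∈ G, Function.update w s(s, t) lam x)) ∧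
      ((∑ G ∈ D₁.powerset.filter (fun G =>
        (fromEdgeSet ((G ∪ (insert e (insert f (insert s(s, t) K₁))) : Finset (Sym2 V)) : Set (Sym2 V))).IsAcyclic), ∏ x ∈ G, w x) *
          (∑ G ∈ D₁.powerset.filter (fun G =>
        (fromEdgeSet ((G ∪ (insert s(s, t) K₁) : Finset (Sym2 V)) : Set (Sym2 V))).IsAcyclic), ∏ x ∈ G, w x) ≤
        (∑ G ∈ D₁.powerset.filter (fun G =>
        (fromEdgeSet ((G ∪ (insert e (insert s(s, t) K₁)) : Finset (Sym2 V)) : Set (Sym2 V))).IsAcyclic), ∏ x ∈ G, w x) *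
          (∑ G ∈ D₁.powerset.filter (fun G =>
        (fromEdgeSet ((G ∪ (insert f (insert s(s, t) K₁)) : Finset (Sym2 V)) : Set (Sym2 V))).IsAcyclic), ∏ x ∈ G, w x)) := by
    intro D₁ K₁ hD₁ hK₁ hD₁D hK₁K
    have hmD₁ : s(s, t) ∉ D₁ := fun h => hm₁ (hD₁ h)
    have hmK₁ : s(s, t) ∉ K₁ := fun h => hm₁ (hK₁ h)
    have heD₁ : e ∉ D₁ := fun h => heD (hD₁D h)
    have heK₁ : e ∉ K₁ := fun h => heK (hK₁K h)
    have hfD₁ : f ∉ D₁ := fun h => hfD (hD₁D h)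
    have hfK₁ : f ∉ K₁ := fun h => hfK (hK₁K h)
    have hDK₁ : Disjoint D₁ K₁ := by
      refine Finset.disjoint_left.2 fun z hz hz' => ?_
      exact Finset.disjoint_left.1 hDK (hD₁D hz) (hK₁K hz')
    have hefK : insert e (insert f K₁) ⊆ insert s(s, t) E₁ :=
      Finset.insert_subset (Finset.mem_insert_of_mem he)
        (Finset.insert_subset (Finset.mem_insert_of_mem hf) (hK₁.trans (Finset.subset_insert _ _)))
    constructor
    · intro lam hl
      refine hR₁ _ (update_nonneg w hw _ hl) (insert s(s, t) D₁) K₁ e f ?_ ?_ ?_ heK₁ ?_ hfK₁ hef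
      · exact Finset.union_subset (Finset.insert_subset_insert _ hD₁) hefK
      · exact Finset.disjoint_insert_left.2 ⟨hmK₁, hDK₁⟩
      · rw [Finset.mem_insert, not_or]; exact ⟨hem, heD₁⟩
      · rw [Finset.mem_insert, not_or]; exact ⟨hfm, hfD₁⟩
    · refine hR₁ w hw D₁ (insert s(s, t) K₁) e f ?_ ?_ heD₁ ?_ hfD₁ ?_ hef
      · refine Finset.union_subset (hD₁.trans (Finset.subset_insert _ _))
          (Finset.insert_subset (Finset.mem_insert_of_mem he)
            (Finset.insert_subset (Finset.mem_insert_of_mem hf)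
              (Finset.insert_subset_insert _ hK₁)))
      · exact Finset.disjoint_insert_right.2 ⟨hmD₁, hDK₁⟩
      · rw [Finset.mem_insert, not_or]; exact ⟨hem, heK₁⟩
      · rw [Finset.mem_insert, not_or]; exact ⟨hfm, hfK₁⟩
  by_cases hmD : s(s, t) ∈ D
  · -- marker free
    have hmK : s(s, t) ∉ K := fun h => Finset.disjoint_left.1 hDK hmD h
    have hDsub' : D.erase s(s, t) ⊆ insert s(s, t) (E₁ ∪ E₂) := (D.erase_subset _).trans hDsub
    obtain ⟨D₁, D₂, hD₁, hD₂, hD₁₂, hDe⟩ := split_sides hDsub' (Finset.notMem_erase _ _)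
    obtain ⟨K₁, K₂, hK₁, hK₂, -, rfl⟩ := split_sides hKsub hmK
    have hDeq : D = insert s(s, t) (D₁ ∪ D₂) := by rw [← hDe, Finset.insert_erase hmD]
    have hD₁D : D₁ ⊆ D := fun z hz => Finset.mem_of_mem_erase (hDe ▸ Finset.mem_union_left _ hz)
    have hD₂D : D₂ ⊆ D := fun z hz => Finset.mem_of_mem_erase (hDe ▸ Finset.mem_union_right _ hz)
    obtain ⟨hlam, hpin⟩ := inputs D₁ K₁ hD₁ hK₁ hD₁D Finset.subset_union_left
    rw [hDeq]
    have hA₁ : D₁ ∪ insert e (insert f K₁) ⊆ E₁ :=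
      Finset.union_subset hD₁ (Finset.insert_subset he (Finset.insert_subset hf hK₁))
    have hA₂ : D₂ ∪ K₂ ⊆ E₂ := Finset.union_subset hD₂ hK₂
    exact lsm_sep_same_free w hw e f (fun z hz => hE₁ z (hA₁ hz)) (fun z hz => hE₂ z (hA₂ hz))
      hS hst (fun z hz => hL₁ z (hA₁ hz)) (fun z hz => hL₂ z (hA₂ hz)) (fun h => hm₁ (hA₁ h))
      (fun h => hm₂ (hA₂ h)) hD₁₂ hlam hpin
  by_cases hmK : s(s, t) ∈ K
  · -- marker pinned
    have hKsub' : K.erase s(s, t) ⊆ insert s(s, t) (E₁ ∪ E₂) := (K.erase_subset _).trans hKsub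
    obtain ⟨D₁, D₂, hD₁, hD₂, hD₁₂, rfl⟩ := split_sides hDsub hmD
    obtain ⟨K₁, K₂, hK₁, hK₂, -, hKe⟩ := split_sides hKsub' (Finset.notMem_erase _ _)
    have hKeq : K = insert s(s, t) (K₁ ∪ K₂) := by rw [← hKe, Finset.insert_erase hmK]
    have hK₁K : K₁ ⊆ K := fun z hz => Finset.mem_of_mem_erase (hKe ▸ Finset.mem_union_left _ hz)
    obtain ⟨-, hpin⟩ := inputs D₁ K₁ hD₁ hK₁ Finset.subset_union_left hK₁K
    rw [hKeq]
    have hA₁ : D₁ ∪ insert e (insert f K₁) ⊆ E₁ :=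
      Finset.union_subset hD₁ (Finset.insert_subset he (Finset.insert_subset hf hK₁))
    have hA₂ : D₂ ∪ K₂ ⊆ E₂ := Finset.union_subset hD₂ hK₂
    exact lsm_sep_same_pin w hw e f (fun z hz => hE₁ z (hA₁ hz)) (fun z hz => hE₂ z (hA₂ hz))
      hS hst (fun z hz => hL₁ z (hA₁ hz)) (fun z hz => hL₂ z (hA₂ hz)) (fun h => hm₁ (hA₁ h))
      (fun h => hm₂ (hA₂ h)) hD₁₂ hpin
  · -- marker absent
    obtain ⟨D₁, D₂, hD₁, hD₂, hD₁₂, rfl⟩ := split_sides hDsub hmD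
    obtain ⟨K₁, K₂, hK₁, hK₂, -, rfl⟩ := split_sides hKsub hmK
    obtain ⟨hlam, hpin⟩ := inputs D₁ K₁ hD₁ hK₁ Finset.subset_union_left Finset.subset_union_left
    have hA₁ : D₁ ∪ insert e (insert f K₁) ⊆ E₁ :=
      Finset.union_subset hD₁ (Finset.insert_subset he (Finset.insert_subset hf hK₁))
    have hA₂ : D₂ ∪ K₂ ⊆ E₂ := Finset.union_subset hD₂ hK₂
    exact lsm_sep_same w hw e f (fun z hz => hE₁ z (hA₁ hz)) (fun z hz => hE₂ z (hA₂ hz))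
      hS hst (fun z hz => hL₁ z (hA₁ hz)) (fun z hz => hL₂ z (hA₂ hz)) (fun h => hm₁ (hA₁ h))
      (fun h => hm₂ (hA₂ h)) hD₁₂ hlam hpin

/-- **Case `e` on side 1, `f` on side 2** (marker absent, free or pinned).
[S–W 2008 §5 Q.2, graphic case] -/
theorem twoSum_case_split
    {E₁ E₂ : Finset (Sym2 V)} {S₁ S₂ : Set V} {s t : V}
    (hE₁ : ∀ z ∈ E₁, ∀ x ∈ z, x ∈ S₁) (hE₂ : ∀ z ∈ E₂, ∀ x ∈ z, x ∈ S₂)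
    (hS : ∀ x, x ∈ S₁ → x ∈ S₂ → x = s ∨ x = t) (hst : s ≠ t)
    (hL₁ : ∀ z ∈ E₁, ¬z.IsDiag) (hL₂ : ∀ z ∈ E₂, ¬z.IsDiag)
    (hm₁ : s(s, t) ∉ E₁) (hm₂ : s(s, t) ∉ E₂)
    (hR₁ : ∀ (w : Sym2 V → ℝ), (∀ x, 0 ≤ w x) → ∀ (D K : Finset (Sym2 V)) (e f : Sym2 V),
      D ∪ insert e (insert f K) ⊆ insert s(s, t) E₁ → Disjoint D K → e ∉ D → e ∉ K → f ∉ D →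
      f ∉ K → e ≠ f →
      (∑ G ∈ D.powerset.filter (fun G =>
        (fromEdgeSet ((G ∪ (insert e (insert f K)) : Finset (Sym2 V)) : Set (Sym2 V))).IsAcyclic), ∏ x ∈ G, w x) *
        (∑ G ∈ D.powerset.filter (fun G =>
        (fromEdgeSet ((G ∪ (K) : Finset (Sym2 V)) : Set (Sym2 V))).IsAcyclic), ∏ x ∈ G, w x) ≤
      (∑ G ∈ D.powerset.filter (fun G =>
        (fromEdgeSet ((G ∪ (insert e K) : Finset (Sym2 V)) : Set (Sym2 V))).IsAcyclic), ∏ x ∈ G, w x) *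
        (∑ G ∈ D.powerset.filter (fun G =>
        (fromEdgeSet ((G ∪ (insert f K) : Finset (Sym2 V)) : Set (Sym2 V))).IsAcyclic), ∏ x ∈ G, w x))
    (hR₂ : ∀ (w : Sym2 V → ℝ), (∀ x, 0 ≤ w x) → ∀ (D K : Finset (Sym2 V)) (e f : Sym2 V),
      D ∪ insert e (insert f K) ⊆ insert s(s, t) E₂ → Disjoint D K → e ∉ D → e ∉ K → f ∉ D →
      f ∉ K → e ≠ f →
      (∑ G ∈ D.powerset.filter (fun G =>
        (fromEdgeSet ((G ∪ (insert e (insert f K)) : Finset (Sym2 V)) : Set (Sym2 V))).IsAcyclic), ∏ x ∈ G, w x) *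
        (∑ G ∈ D.powerset.filter (fun G =>
        (fromEdgeSet ((G ∪ (K) : Finset (Sym2 V)) : Set (Sym2 V))).IsAcyclic), ∏ x ∈ G, w x) ≤
      (∑ G ∈ D.powerset.filter (fun G =>
        (fromEdgeSet ((G ∪ (insert e K) : Finset (Sym2 V)) : Set (Sym2 V))).IsAcyclic), ∏ x ∈ G, w x) *
        (∑ G ∈ D.powerset.filter (fun G =>
        (fromEdgeSet ((G ∪ (insert f K) : Finset (Sym2 V)) : Set (Sym2 V))).IsAcyclic), ∏ x ∈ G, w x))
    (w : Sym2 V → ℝ) (hw : ∀ x, 0 ≤ w x) (D K : Finset (Sym2 V)) (e f : Sym2 V)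
    (hsub : D ∪ insert e (insert f K) ⊆ insert s(s, t) (E₁ ∪ E₂)) (hDK : Disjoint D K)
    (heD : e ∉ D) (heK : e ∉ K) (hfD : f ∉ D) (hfK : f ∉ K)
    (he : e ∈ E₁) (hf : f ∈ E₂) :
    (∑ G ∈ D.powerset.filter (fun G =>
        (fromEdgeSet ((G ∪ (insert e (insert f K)) : Finset (Sym2 V)) : Set (Sym2 V))).IsAcyclic), ∏ x ∈ G, w x) *
      (∑ G ∈ D.powerset.filter (fun G =>
        (fromEdgeSet ((G ∪ (K) : Finset (Sym2 V)) : Set (Sym2 V))).IsAcyclic), ∏ x ∈ G, w x) ≤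
    (∑ G ∈ D.powerset.filter (fun G =>
        (fromEdgeSet ((G ∪ (insert e K) : Finset (Sym2 V)) : Set (Sym2 V))).IsAcyclic), ∏ x ∈ G, w x) *
      (∑ G ∈ D.powerset.filter (fun G =>
        (fromEdgeSet ((G ∪ (insert f K) : Finset (Sym2 V)) : Set (Sym2 V))).IsAcyclic), ∏ x ∈ G, w x) := by
  have hem : e ≠ s(s, t) := fun h => hm₁ (h ▸ he)
  have hfm : f ≠ s(s, t) := fun h => hm₂ (h ▸ hf)
  have hDsub : D ⊆ insert s(s, t) (E₁ ∪ E₂) := fun z hz => hsub (Finset.mem_union_left _ hz)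
  have hKsub : K ⊆ insert s(s, t) (E₁ ∪ E₂) := fun z hz =>
    hsub (Finset.mem_union_right _ (Finset.mem_insert_of_mem (Finset.mem_insert_of_mem hz)))
  -- the two one-sided inputs `(R)(D₁;K₁;e,m)` and `(R)(D₂;K₂;f,m)`
  have input₁ : ∀ D₁ K₁ : Finset (Sym2 V), D₁ ⊆ E₁ → K₁ ⊆ E₁ → D₁ ⊆ D → K₁ ⊆ K →
      (∑ G ∈ D₁.powerset.filter (fun G =>
        (fromEdgeSet ((G ∪ (insert e (insert s(s, t) K₁)) : Finset (Sym2 V)) : Set (Sym2 V))).IsAcyclic), ∏ x ∈ G, w x) *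
        (∑ G ∈ D₁.powerset.filter (fun G =>
        (fromEdgeSet ((G ∪ (K₁) : Finset (Sym2 V)) : Set (Sym2 V))).IsAcyclic), ∏ x ∈ G, w x) ≤
      (∑ G ∈ D₁.powerset.filter (fun G =>
        (fromEdgeSet ((G ∪ (insert e K₁) : Finset (Sym2 V)) : Set (Sym2 V))).IsAcyclic), ∏ x ∈ G, w x) *
        (∑ G ∈ D₁.powerset.filter (fun G =>
        (fromEdgeSet ((G ∪ (insert s(s, t) K₁) : Finset (Sym2 V)) : Set (Sym2 V))).IsAcyclic), ∏ x ∈ G, w x) := by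
    intro D₁ K₁ hD₁ hK₁ hD₁D hK₁K
    refine hR₁ w hw D₁ K₁ e s(s, t) ?_ ?_ (fun h => heD (hD₁D h)) (fun h => heK (hK₁K h))
      (fun h => hm₁ (hD₁ h)) (fun h => hm₁ (hK₁ h)) hem
    · exact Finset.union_subset (hD₁.trans (Finset.subset_insert _ _))
        (Finset.insert_subset (Finset.mem_insert_of_mem he)
          (Finset.insert_subset (Finset.mem_insert_self _ _) (hK₁.trans (Finset.subset_insert _ _))))
    · refine Finset.disjoint_left.2 fun z hz hz' => ?_
      exact Finset.disjoint_left.1 hDK (hD₁D hz) (hK₁K hz')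
  have input₂ : ∀ D₂ K₂ : Finset (Sym2 V), D₂ ⊆ E₂ → K₂ ⊆ E₂ → D₂ ⊆ D → K₂ ⊆ K →
      (∑ G ∈ D₂.powerset.filter (fun G =>
        (fromEdgeSet ((G ∪ (insert f (insert s(s, t) K₂)) : Finset (Sym2 V)) : Set (Sym2 V))).IsAcyclic), ∏ x ∈ G, w x) *
        (∑ G ∈ D₂.powerset.filter (fun G =>
        (fromEdgeSet ((G ∪ (K₂) : Finset (Sym2 V)) : Set (Sym2 V))).IsAcyclic), ∏ x ∈ G, w x) ≤
      (∑ G ∈ D₂.powerset.filter (fun G =>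
        (fromEdgeSet ((G ∪ (insert f K₂) : Finset (Sym2 V)) : Set (Sym2 V))).IsAcyclic), ∏ x ∈ G, w x) *
        (∑ G ∈ D₂.powerset.filter (fun G =>
        (fromEdgeSet ((G ∪ (insert s(s, t) K₂) : Finset (Sym2 V)) : Set (Sym2 V))).IsAcyclic), ∏ x ∈ G, w x) := by
    intro D₂ K₂ hD₂ hK₂ hD₂D hK₂K
    refine hR₂ w hw D₂ K₂ f s(s, t) ?_ ?_ (fun h => hfD (hD₂D h)) (fun h => hfK (hK₂K h))
      (fun h => hm₂ (hD₂ h)) (fun h => hm₂ (hK₂ h)) hfm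
    · exact Finset.union_subset (hD₂.trans (Finset.subset_insert _ _))
        (Finset.insert_subset (Finset.mem_insert_of_mem hf)
          (Finset.insert_subset (Finset.mem_insert_self _ _) (hK₂.trans (Finset.subset_insert _ _))))
    · refine Finset.disjoint_left.2 fun z hz hz' => ?_
      exact Finset.disjoint_left.1 hDK (hD₂D hz) (hK₂K hz')
  by_cases hmD : s(s, t) ∈ D
  · -- marker free
    have hmK : s(s, t) ∉ K := fun h => Finset.disjoint_left.1 hDK hmD h
    have hDsub' : D.erase s(s, t) ⊆ insert s(s, t) (E₁ ∪ E₂) := (D.erase_subset _).trans hDsub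
    obtain ⟨D₁, D₂, hD₁, hD₂, hD₁₂, hDe⟩ := split_sides hDsub' (Finset.notMem_erase _ _)
    obtain ⟨K₁, K₂, hK₁, hK₂, -, rfl⟩ := split_sides hKsub hmK
    have hDeq : D = insert s(s, t) (D₁ ∪ D₂) := by rw [← hDe, Finset.insert_erase hmD]
    have hD₁D : D₁ ⊆ D := fun z hz => Finset.mem_of_mem_erase (hDe ▸ Finset.mem_union_left _ hz)
    have hD₂D : D₂ ⊆ D := fun z hz => Finset.mem_of_mem_erase (hDe ▸ Finset.mem_union_right _ hz)
    have hRe := input₁ D₁ K₁ hD₁ hK₁ hD₁D Finset.subset_union_left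
    have hRf := input₂ D₂ K₂ hD₂ hK₂ hD₂D Finset.subset_union_right
    rw [hDeq]
    have hA₁ : D₁ ∪ insert e K₁ ⊆ E₁ := Finset.union_subset hD₁ (Finset.insert_subset he hK₁)
    have hA₂ : D₂ ∪ insert f K₂ ⊆ E₂ := Finset.union_subset hD₂ (Finset.insert_subset hf hK₂)
    exact lsm_sep_split_free w e f (fun z hz => hE₁ z (hA₁ hz)) (fun z hz => hE₂ z (hA₂ hz))
      hS hst (fun z hz => hL₁ z (hA₁ hz)) (fun z hz => hL₂ z (hA₂ hz)) (fun h => hm₁ (hA₁ h))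
      (fun h => hm₂ (hA₂ h)) hD₁₂ hRe hRf
  by_cases hmK : s(s, t) ∈ K
  · -- marker pinned
    have hKsub' : K.erase s(s, t) ⊆ insert s(s, t) (E₁ ∪ E₂) := (K.erase_subset _).trans hKsub
    obtain ⟨D₁, D₂, hD₁, hD₂, hD₁₂, rfl⟩ := split_sides hDsub hmD
    obtain ⟨K₁, K₂, hK₁, hK₂, -, hKe⟩ := split_sides hKsub' (Finset.notMem_erase _ _)
    have hKeq : K = insert s(s, t) (K₁ ∪ K₂) := by rw [← hKe, Finset.insert_erase hmK]
    rw [hKeq]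
    have hA₁ : D₁ ∪ insert e K₁ ⊆ E₁ := Finset.union_subset hD₁ (Finset.insert_subset he hK₁)
    have hA₂ : D₂ ∪ insert f K₂ ⊆ E₂ := Finset.union_subset hD₂ (Finset.insert_subset hf hK₂)
    exact lsm_sep_split_pin w e f (fun z hz => hE₁ z (hA₁ hz)) (fun z hz => hE₂ z (hA₂ hz))
      hS hst (fun z hz => hL₁ z (hA₁ hz)) (fun z hz => hL₂ z (hA₂ hz)) (fun h => hm₁ (hA₁ h))
      (fun h => hm₂ (hA₂ h)) hD₁₂
  · -- marker absent
    obtain ⟨D₁, D₂, hD₁, hD₂, hD₁₂, rfl⟩ := split_sides hDsub hmD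
    obtain ⟨K₁, K₂, hK₁, hK₂, -, rfl⟩ := split_sides hKsub hmK
    have hRe := input₁ D₁ K₁ hD₁ hK₁ Finset.subset_union_left Finset.subset_union_left
    have hRf := input₂ D₂ K₂ hD₂ hK₂ Finset.subset_union_right Finset.subset_union_right
    have hA₁ : D₁ ∪ insert e K₁ ⊆ E₁ := Finset.union_subset hD₁ (Finset.insert_subset he hK₁)
    have hA₂ : D₂ ∪ insert f K₂ ⊆ E₂ := Finset.union_subset hD₂ (Finset.insert_subset hf hK₂)
    exact lsm_sep_split w e f (fun z hz => hE₁ z (hA₁ hz)) (fun z hz => hE₂ z (hA₂ hz))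
      hS hst (fun z hz => hL₁ z (hA₁ hz)) (fun z hz => hL₂ z (hA₂ hz)) (fun h => hm₁ (hA₁ h))
      (fun h => hm₂ (hA₂ h)) hD₁₂ hRe hRf

end Summit.CriticalPhenomena.PercolationContinuityZ3.Theorems.ForestRayleigh
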